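import Summits.CriticalPhenomena.PercolationContinuityZ3.Theorems.PercNearOneGluingNoHeavyPcintKernNFZ5B7Defs
import Summits.CriticalPhenomena.PercolationContinuityZ3.Theorems.PercNearOneGluingNoHeavyPcintWinKernelTree
import HarnessLib

/-!
# PCINT lane, kernel check 3/4 of the B3r window certificate `d = 5`, memory 7 (6-step windows; 1538 first-use normal forms of 1000000 codes): normal-form codes in `[402000, 524020)`

Cell `prim-pcint`, seat `prim-pcint-2` (gen 2).  Collatz–Wielandt rows `10^5 · row ≤ 99999 · DEN · v` on the 257 normal-form codes in
`[402000, 524020)` (`WinK.nfCodesIn`), by `decide +kernel` in blocks of at most `48` rows (`WinK.allB`, natural-number arithmetic only;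
`maxHeartbeats 0`) — table values read from the search tree `WinK.KT.ofListF 11 tbl` (`…PcintWinKernelTree`; check 1/4,
`…KernNFZ5B7Check1`, covers `[0, 276420)` with the linear table).  Does NOT build on p205010.
-/

namespace Summit.CriticalPhenomena.PercolationContinuityZ3.Theorems.Pcint.NFZ5B7

set_option maxHeartbeats 0 in
/-- The 48 rows with normal-form code in `[402000, 412210)` hold. [folklore] -/
theorem chk_402000_412210 : (WinK.nfCodesIn 5 6 402000 412210).all (WinK.rowOKBT 5 5 1145 10066 9935 99999 (WinK.KT.ofListF 11 tbl) 72351) = true :=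
  WinK.all_of_allB (fuel := 20) (by decide +kernel)

set_option maxHeartbeats 0 in
/-- The 48 rows with normal-form code in `[412210, 422200)` hold. [folklore] -/
theorem chk_412210_422200 : (WinK.nfCodesIn 5 6 412210 422200).all (WinK.rowOKBT 5 5 1145 10066 9935 99999 (WinK.KT.ofListF 11 tbl) 72351) = true :=
  WinK.all_of_allB (fuel := 20) (by decide +kernel)

set_option maxHeartbeats 0 in
/-- The 48 rows with normal-form code in `[422200, 433200)` hold. [folklore] -/
theorem chk_422200_433200 : (WinK.nfCodesIn 5 6 422200 433200).all (WinK.rowOKBT 5 5 1145 10066 9935 99999 (WinK.KT.ofListF 11 tbl) 72351) = true :=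
  WinK.all_of_allB (fuel := 20) (by decide +kernel)

set_option maxHeartbeats 0 in
/-- The 48 rows with normal-form code in `[433200, 444200)` hold. [folklore] -/
theorem chk_433200_444200 : (WinK.nfCodesIn 5 6 433200 444200).all (WinK.rowOKBT 5 5 1145 10066 9935 99999 (WinK.KT.ofListF 11 tbl) 72351) = true :=
  WinK.all_of_allB (fuel := 20) (by decide +kernel)

set_option maxHeartbeats 0 in
/-- The 48 rows with normal-form code in `[444200, 510420)` hold. [folklore] -/
theorem chk_444200_510420 : (WinK.nfCodesIn 5 6 444200 510420).all (WinK.rowOKBT 5 5 1145 10066 9935 99999 (WinK.KT.ofListF 11 tbl) 72351) = true :=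
  WinK.all_of_allB (fuel := 20) (by decide +kernel)

set_option maxHeartbeats 0 in
/-- The 17 rows with normal-form code in `[510420, 524020)` hold. [folklore] -/
theorem chk_510420_524020 : (WinK.nfCodesIn 5 6 510420 524020).all (WinK.rowOKBT 5 5 1145 10066 9935 99999 (WinK.KT.ofListF 11 tbl) 72351) = true :=
  WinK.all_of_allB (fuel := 20) (by decide +kernel)

/-- The rows with normal-form code in `[402000, 524020)` hold. [folklore] -/
theorem chkFile_3 : (WinK.nfCodesIn 5 6 402000 524020).all (WinK.rowOKBT 5 5 1145 10066 9935 99999 (WinK.KT.ofListF 11 tbl) 72351) = true :=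
  WinK.all_nfCodesIn_append (WinK.all_nfCodesIn_append (WinK.all_nfCodesIn_append (WinK.all_nfCodesIn_append (WinK.all_nfCodesIn_append chk_402000_412210 chk_412210_422200) chk_422200_433200) chk_433200_444200) chk_444200_510420) chk_510420_524020

end Summit.CriticalPhenomena.PercolationContinuityZ3.Theorems.Pcint.NFZ5B7
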